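import Summits.QuantumFields.YangMills.Theorems.FlatTubeReductionDressedClusterAbsorption
import Summits.QuantumFields.YangMills.Theorems.LuscherReductionOneSiteLevelsClosed
import Literature.Analysis.OperatorTheory.YangMillsMatrixModelLuscherSimonGapHolds
import HarnessLib

/-!
# The one-site input of the DRESSED no-intruder: the route-posited sub-target `OneSiteEigenMoments` (EM), and the CLUSTER GAP from crux ONE + `LuscherSimonGap`
# (route `FlatTubeReduction`, crux K1 `NearFlatRatioLaw` stmt-QuantumFields-24720; seat `ym-line-ftr-p1` g10; R2b1 RECORD rung — no summit statement is proved here)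

The dressed one-site no-intruder `BORateBricksD.hDS` (p656759) follows from the cluster-absorption lemma `qform_dressed_le_of_cluster` (p657808) once two one-site inputs
are supplied (crux workfile `Cruxes/NearFlatRatioLaw/Lines/ratepack-dressing-g10.md` §3):
* ★ `OneSiteEigenMoments` — THE NEW ONE-SITE SUB-TARGET (EM), route-posited here (a `Prop`, NOT a published theorem): for every `m`, eventually in `B`, every physical
  EXACT eigenfunction `φ` of the one-site transfer operator at one of the top `m+1` levels has second moment `∫_{orbitDist<1/2} orbitDist²·φ² ≤ S·λ_b(B)²·‖φ‖²` near the
  trivial orbit (Airy/Agmon localisation of the low one-site eigenfunctions at the slow scale `B^{-1/3}`; intended proof: quasimode residuals `O(λ_b²)` for crux ONE's trial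
  states + Davis–Kahan, or a lattice Agmon estimate — OPEN, L-sized);
* ★★ `cluster_gap` — PROVED: for every level `k` and slope `A ≥ 0` there is an index `n ≥ k+1` and constants such that eventually in `B`:
  `μ_n(1 + 2Aλ_b) ≤ μ_k` (a full cluster gap below `μ_k`, absorbing a dressing `κ̄ ≤ Aλ_b`), `μ_k − μ_n ≤ C_g λ_b μ_k`, `μ₀/2 ≤ μ_k`, `λ_b ≤ 1`
  (crux ONE two-sided levels `oneSiteLevels_proof` at `k` and `n` + `LuscherSimonGap_holds`: `physLevel → ∞`).
HONEST FRAMING: (EM) is an OPEN fixed-`B → ∞` semiclassical statement about the one-site three-matrix model (finite-dimensional configuration space `SU(2)³`); `cluster_gap`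
is bookkeeping over the PROVED crux ONE; femto rung R2b1 (RECORD label); not infinite volume, not a gap, not Clay.  One new `def` (a `Prop`), no named facts, no `sorry`.
-/

set_option autoImplicit false

noncomputable section

open MeasureTheory Filter Topology Real
open scoped BigOperators
open Literature.MathematicalPhysics.QuantumFieldTheory
open Literature.MathematicalPhysics.QuantumLattice
open Literature.Analysis.OperatorTheory.YMMatrixModel

namespace Summit.QuantumFields.YangMills.Theorems.FemtoTransferGap.RateTube

open Summit.QuantumFields.YangMills.Theorems.FemtoTransferGap

/-! ## §1 ★ The route-posited one-site sub-target (EM) -/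

/-- ★ **(EM) ONE-SITE EIGENFUNCTION SECOND MOMENTS** (route-posited sub-target of the rate twin of crux K1; OPEN).  For every `m` there are `S ≥ 0`, `B₀` such that for
`B ≥ B₀` every physical exact eigenfunction `φ` of the one-site `SU(2)` transfer operator at a level `j ≤ m` (`K_B φ = μ_j(B)·φ` pointwise) satisfies
`∫_{orbitDist u < 1/2} orbitDist(u)²·φ(u)² du ≤ S·λ_b(B)²·‖φ‖²` — the low eigenfunctions live at the slow scale `orbitDist ≍ B^{-1/3} ≍ λ_b` near each central orbit
(Lüscher's zero-momentum modes; Airy confinement along the toron valleys).  Intended proof: `O(λ_b²)` quasimode residuals for crux ONE's trial states + Davis–Kahan against the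
exact eigenfamily (`PhysL2.exists_isPhys_eigenfamily`), or a lattice Agmon estimate.  Target text of this programme (Lüscher 1983 §2–§3 zero-momentum modes; B. Simon 1983
§3), NOT a published theorem. -/
def OneSiteEigenMoments : Prop :=
  ∀ m : ℕ, ∃ S B₀ : ℝ, 0 ≤ S ∧ ∀ B : ℝ, B₀ ≤ B → ∀ φ : GaugeConfig 3 1 SU2 → ℝ, IsPhys φ →
    (∃ j : ℕ, j ≤ m ∧ transferApply B φ = levelValue su2Rep 1 B j • φ) →
      ∫ u, (if orbitDist u < 1 / 2 then orbitDist u ^ 2 else 0) * φ u ^ 2 ∂configMeasure SU2 1 ≤ S * bareLambda B ^ 2 * l2 φ φ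

/-! ## §2 ★★ The cluster gap below a level, from crux ONE and `physLevel → ∞` -/

set_option maxHeartbeats 400000 in
/-- ★★ **CLUSTER GAP.**  For every level `k` and every `A ≥ 0` there are an index `n ≥ k + 1` and `C_g ≥ 0`, `B₀` such that for all `B ≥ B₀`, with `μ_j = levelValue su2Rep 1 B j`
and `λ = λ_b(B)`: `0 < μ₀`, `μ₀/2 ≤ μ_k`, `0 ≤ μ_n`, `μ_n·(1 + 2Aλ) ≤ μ_k` and `μ_k − μ_n ≤ C_g·λ·μ_k`, `0 < λ ≤ 1`.  (`n` = the first index past which `physLevel` exceeds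
`physLevel (k+1) + 2A + 2`, by `LuscherSimonGap_holds`; the inequalities are crux ONE's two-sided levels at `k` and `n`.) [cite: Luscher1983, §2] [cite: SimonB1983DiscreteSpectrum, Cor. 4] -/
theorem cluster_gap (k : ℕ) {A : ℝ} (hA : 0 ≤ A) :
    ∃ n : ℕ, k + 1 ≤ n ∧ ∃ Cg B₀ : ℝ, 0 ≤ Cg ∧ ∀ B : ℝ, B₀ ≤ B →
      0 < levelValue su2Rep 1 B 0 ∧ levelValue su2Rep 1 B 0 / 2 ≤ levelValue su2Rep 1 B k ∧ 0 ≤ levelValue su2Rep 1 B n ∧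
      levelValue su2Rep 1 B n * (1 + 2 * A * bareLambda B) ≤ levelValue su2Rep 1 B k ∧
      levelValue su2Rep 1 B k - levelValue su2Rep 1 B n ≤ Cg * bareLambda B * levelValue su2Rep 1 B k ∧
      0 < bareLambda B ∧ bareLambda B ≤ 1 := by
  -- the index `n`
  obtain ⟨htend, -⟩ := LuscherSimonGap_holds
  obtain ⟨N, hN⟩ := (Filter.tendsto_atTop_atTop.mp htend) (physLevel (k + 1) + (2 * A + 2))
  set n : ℕ := max (k + 1) N with hn
  have hkn : k + 1 ≤ n := le_max_left _ _
  have hgapE : 2 * A + 2 ≤ levelGap n - levelGap k := by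
    have h1 : physLevel (k + 1) + (2 * A + 2) ≤ physLevel (n + 1) := hN (n + 1) ((le_max_right _ _).trans (Nat.le_succ n))
    unfold levelGap; linarith
  -- crux ONE at `k` and at `n`
  obtain ⟨Ck, Bk, hk⟩ := oneSiteLevels_proof k
  obtain ⟨Cn, Bn, hn'⟩ := oneSiteLevels_proof n
  set g : ℝ := levelGap n - levelGap k with hg
  have hg0 : 0 ≤ g := by linarith
  set C' : ℝ := |Ck| + |Cn| with hC'
  have hC'0 : 0 ≤ C' := by positivity
  -- smallness threshold for `λ`
  set τ : ℝ := min (1 / (2 * (|levelGap k| + |Ck| + 2))) (1 / (C' + 1)) with hτ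
  have hτ0 : 0 < τ := by rw [hτ]; exact lt_min (by positivity) (by positivity)
  refine ⟨n, hkn, g + C', max (max Bk Bn) (max 1 (2 / τ ^ 3)), by positivity, fun B hB => ?_⟩
  have hBk : Bk ≤ B := ((le_max_left _ _).trans (le_max_left _ _)).trans hB
  have hBn : Bn ≤ B := ((le_max_right _ _).trans (le_max_left _ _)).trans hB
  have hB1 : 1 ≤ B := ((le_max_left _ _).trans (le_max_right _ _)).trans hB
  have hBτ : 2 / τ ^ 3 ≤ B := ((le_max_right _ _).trans (le_max_right _ _)).trans hB
  have hB0 : 0 < B := by linarith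
  obtain ⟨hμ0, hkup, hklow⟩ := hk B hBk
  obtain ⟨-, hnup, hnlow⟩ := hn' B hBn
  have hlamτ' : bareLambda (((1 : ℕ) : ℝ) ^ 3 * B) ≤ τ := bareLambda_cube_le (L := 1) hτ0 hBτ
  have e1B : ((1 : ℕ) : ℝ) ^ 3 * B = B := by simp
  rw [e1B] at hlamτ'
  set lam := bareLambda B with hlam
  set μ0 := levelValue su2Rep 1 B 0 with hμ0def
  set μk := levelValue su2Rep 1 B k with hμkdef
  set μn := levelValue su2Rep 1 B n with hμndef
  have hlam0 : 0 < lam := bareLambda_pos' hB0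
  have hlam1 : lam ≤ 1 / (2 * (|levelGap k| + |Ck| + 2)) := hlamτ'.trans (min_le_left _ _)
  have hlamC : lam ≤ 1 / (C' + 1) := hlamτ'.trans (min_le_right _ _)
  obtain ⟨-, -, hy⟩ := smallness_of_le hlam0.le hlam1
  have hlam_le_one : lam ≤ 1 := by
    have h22 : 1 / (2 * (|levelGap k| + |Ck| + 2)) ≤ 1 := by
      rw [div_le_one (by positivity)]; nlinarith [abs_nonneg (levelGap k), abs_nonneg Ck]
    exact hlam1.trans h22
  have hC'lam : C' * lam ≤ 1 := by
    have := (le_div_iff₀ (by positivity : (0:ℝ) < C' + 1)).mp hlamC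
    nlinarith
  -- `μ₀/2 ≤ μ_k`
  have hklow' : Real.exp (-(levelGap k * lam + |Ck| * lam ^ 2)) * μ0 ≤ μk := by
    refine le_trans (mul_le_mul_of_nonneg_right (Real.exp_le_exp.2 ?_) hμ0.le) hklow
    have := mul_le_mul_of_nonneg_right (le_abs_self Ck) (sq_nonneg lam)
    linarith
  have hμk2 : μ0 / 2 ≤ μk := half_le_of_exp_lower hy hμ0.le hklow'
  have hμkpos : 0 < μk := by linarith
  have hμn0 : 0 ≤ μn := le_trans (mul_nonneg (Real.exp_pos _).le hμ0.le) hnlow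
  have hCk : Ck * lam ^ 2 ≤ |Ck| * lam ^ 2 := mul_le_mul_of_nonneg_right (le_abs_self Ck) (sq_nonneg lam)
  have hCn : Cn * lam ^ 2 ≤ |Cn| * lam ^ 2 := mul_le_mul_of_nonneg_right (le_abs_self Cn) (sq_nonneg lam)
  have hCk' : -(|Ck| * lam ^ 2) ≤ Ck * lam ^ 2 := by
    have := mul_le_mul_of_nonneg_right (neg_abs_le Ck) (sq_nonneg lam); linarith
  have hCn' : -(|Cn| * lam ^ 2) ≤ Cn * lam ^ 2 := by
    have := mul_le_mul_of_nonneg_right (neg_abs_le Cn) (sq_nonneg lam); linarith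
  -- `μ_n ≤ e^{−gλ + C'λ²} μ_k`
  have hup : μn ≤ Real.exp (-(g * lam) + C' * lam ^ 2) * μk := by
    have h1 : μ0 ≤ Real.exp (levelGap k * lam + Ck * lam ^ 2) * μk := by
      have h := mul_le_mul_of_nonneg_left hklow (Real.exp_pos (levelGap k * lam + Ck * lam ^ 2)).le
      have e : Real.exp (levelGap k * lam + Ck * lam ^ 2) * (Real.exp (-(levelGap k * lam + Ck * lam ^ 2)) * μ0) = μ0 := by
        rw [← mul_assoc, ← Real.exp_add, add_neg_cancel, Real.exp_zero, one_mul]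
      rw [e] at h
      exact h
    have h2 : μn ≤ Real.exp (-(levelGap n * lam - Cn * lam ^ 2)) * (Real.exp (levelGap k * lam + Ck * lam ^ 2) * μk) :=
      hnup.trans (mul_le_mul_of_nonneg_left h1 (Real.exp_pos _).le)
    rw [← mul_assoc, ← Real.exp_add] at h2
    refine h2.trans (mul_le_mul_of_nonneg_right (Real.exp_le_exp.2 ?_) hμkpos.le)
    rw [hg, hC']; linarith
  -- `e^{−gλ − C'λ²} μ_k ≤ μ_n`
  have hlow : Real.exp (-(g * lam) - C' * lam ^ 2) * μk ≤ μn := by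
    have h3 : Real.exp (-(g * lam) - C' * lam ^ 2) * μk ≤
        Real.exp (-(g * lam) - C' * lam ^ 2) * (Real.exp (-(levelGap k * lam - Ck * lam ^ 2)) * μ0) :=
      mul_le_mul_of_nonneg_left hkup (Real.exp_pos _).le
    rw [← mul_assoc, ← Real.exp_add] at h3
    refine h3.trans (le_trans (mul_le_mul_of_nonneg_right (Real.exp_le_exp.2 ?_) hμ0.le) hnlow)
    rw [hg, hC']; linarith
  refine ⟨hμ0, hμk2, hμn0, ?_, ?_, hlam0, hlam_le_one⟩
  · -- `μ_n (1 + 2Aλ) ≤ μ_k`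
    have h1 : 1 + 2 * A * lam ≤ Real.exp (2 * A * lam) := by have := Real.add_one_le_exp (2 * A * lam); linarith
    have e1 : C' * lam ^ 2 ≤ lam := by
      calc C' * lam ^ 2 = (C' * lam) * lam := by ring
        _ ≤ 1 * lam := mul_le_mul_of_nonneg_right hC'lam hlam0.le
        _ = lam := one_mul _
    have e2 : (2 * A + 2) * lam ≤ g * lam := mul_le_mul_of_nonneg_right hgapE hlam0.le
    have hexp1 : Real.exp (-(g * lam) + C' * lam ^ 2 + 2 * A * lam) ≤ 1 := by
      rw [Real.exp_le_one_iff]; linarith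
    have h10 : 0 ≤ 1 + 2 * A * lam := by positivity
    calc μn * (1 + 2 * A * lam) ≤ (Real.exp (-(g * lam) + C' * lam ^ 2) * μk) * (1 + 2 * A * lam) :=
          mul_le_mul_of_nonneg_right hup h10
      _ ≤ (Real.exp (-(g * lam) + C' * lam ^ 2) * μk) * Real.exp (2 * A * lam) :=
          mul_le_mul_of_nonneg_left h1 (mul_nonneg (Real.exp_pos _).le hμkpos.le)
      _ = Real.exp (-(g * lam) + C' * lam ^ 2 + 2 * A * lam) * μk := by rw [Real.exp_add (-(g * lam) + C' * lam ^ 2) (2 * A * lam)]; ring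
      _ ≤ 1 * μk := mul_le_mul_of_nonneg_right hexp1 hμkpos.le
      _ = μk := one_mul _
  · -- `μ_k − μ_n ≤ (g + C')λ μ_k`
    have h1 : 1 - (g * lam + C' * lam ^ 2) ≤ Real.exp (-(g * lam) - C' * lam ^ 2) := by
      have := Real.add_one_le_exp (-(g * lam) - C' * lam ^ 2); linarith
    have h2 : μk - μn ≤ (g * lam + C' * lam ^ 2) * μk := by
      have := mul_le_mul_of_nonneg_right h1 hμkpos.le
      linarith [hlow]
    have h3 : (g * lam + C' * lam ^ 2) * μk ≤ (g + C') * lam * μk := by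
      refine mul_le_mul_of_nonneg_right ?_ hμkpos.le
      have : C' * lam ^ 2 ≤ C' * lam := by
        have := mul_le_mul_of_nonneg_left (show lam ^ 2 ≤ lam by nlinarith) hC'0; linarith
      linarith
    exact h2.trans h3

end Summit.QuantumFields.YangMills.Theorems.FemtoTransferGap.RateTube

end
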